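import Literature.NumberTheory.Automorphic.QuadraticLocalNormTestLocallyConstant   -- ★ p835145: `isOpen_setOf_isUnit_localRing`, `isEmbedding_units_val_localRing` (units of `Π E_w` open ∕ embedded)
import Literature.GroupTheory.PiCharacterFactorsFinitely                          -- ★ `GroupTheory.PiCharacter.isNSSNhd_units_complex` (`ℂˣ` has no small subgroups), `IsNSSNhd`
import HarnessLib

/-!
# A continuous `ℂˣ`-valued character of `(E ⊗_F F_v)^× = Π_{w ∣ v} E_w^×` is LOCALLY CONSTANT: it is trivial on a principal congruence box
# `{u : |u_w − 1|_w < q_w^{−n} ∀ w}` (non-archimedean groups have small open subgroups, `ℂˣ` has no small subgroups; Tate (1967) §2.3, Weil BNT VII §3)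

Topic `NumberTheory/Automorphic`; namespace `Literature.NumberTheory.Automorphic.UnitaryGroup` (home of ★ `LocalRing E v = Π_{w ∣ v} E_w`).  THEOREMS ONLY (no
definition, no named fact, no instance, no notation, no `sorry`; net debt 0).  Cell `pub/hodgecm-mathlib`, F0∕P3a, topic T6 (#88 side, road letter «D-G4♭-lc» of
`SIZING-S1prime` §2∕§5: the `p`-adic sharpening «eventually CONSTANT» of ★ `FinExplicitTransferFactorLocallyConstant`'s «continuous», consumed by
`Rogawski1990/FinExplicitTransferFactorEventuallyConst` for `μ_v` = ★ `finHeckeValue`).  Mathlib-only footing; count-neutral for the books.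

THE MATHEMATICS.  Let `χ : (Π_{w∣v} E_w)^× → ℂˣ` be a continuous homomorphism (the unit group carries the subspace topology of `Π E_w`, ★
`isEmbedding_units_val_localRing`).  `ℂˣ` has a neighbourhood `V` of `1` containing no non-trivial subgroup (★ `GroupTheory.PiCharacter.isNSSNhd_units_complex`); `χ⁻¹(V)`
is a neighbourhood of `1`, hence contains a box `B_n = {u : v_w(u_w − 1) < q_w^{−n} ∀ w}` (the product topology of the valued fields `E_w`, ★
`exists_exp_lt_of_mem_nhds`); for `n ≥ 1` the box `B_n` is a SUBGROUP (ultrametric inequality: `ab − 1 = (a−1)(b−1) + (a−1) + (b−1)`, `a⁻¹ − 1 = −a⁻¹(a − 1)` with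
`|a| = 1`), so `χ(B_n) ⊆ V` is a subgroup, hence trivial: `χ = 1` on `B_n`.  Consequently `χ` is constant near every point (`χ(u) = χ(u₀) χ(u₀⁻¹u)`), and a
function on `Π E_w` that agrees with `χ` on the (open) units is constant near every unit.

* §1 `localRing_box_sub_one_mem_nhds_one` (the box `B_n` is a neighbourhood of `1` in `Π E_w`), `exists_localRing_box_subset_of_mem_nhds_one` (every neighbourhood of `1` contains
  a box).
* §2 **`exists_forall_box_apply_eq_one`** — `∃ n, ∀ u, (∀ w, v_w(u_w − 1) < q_w^{−(n+1)}) → χ u = 1`; **`eventually_apply_eq_of_continuous`** — `∀ᶠ u in 𝓝 u₀,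
  χ u = χ u₀`; **`eventually_eq_of_eq_apply_unit_of_locallyConstant`** — for `f : Π E_w → X` with `f y = g (y as a unit)` at units and `g` constant near every
  point of the unit group: `∀ᶠ y in 𝓝 x, f y = f x` at every unit `x`.

HONEST LABEL: HC_CM is proved only modulo the printed citations (named inputs remaining 2) until rung 0 closes; this file is local topology∕algebra and proves none
of them.

## References
* [TateThesis1967] J. Tate, *Fourier analysis in number fields and Hecke's zeta-functions* (1950∕1967), §2.3 (quasi-characters of a local field: trivial on some
  `1 + 𝔭^n`; the conductor).
* [CasselsFrohlichANT1967] J. W. S. Cassels, A. Fröhlich (eds.), *Algebraic Number Theory* (1967), Ch. II §§10–11 (`E ⊗_F F_v ≅ Π_{w∣v} E_w`).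
-/

set_option autoImplicit false

noncomputable section

open NumberField IsDedekindDomain Filter Topology

namespace Literature.NumberTheory.Automorphic.UnitaryGroup

variable {F : Type} (E : Type) [Field F] [NumberField F] [Field E] [NumberField E] [Algebra F E]
variable (v : HeightOneSpectrum (𝓞 F))

/-! ## §1 Principal congruence boxes in `Π_{w ∣ v} E_w` -/

/-- **The box `{x : v_w(x_w − 1) < q_w^{−n} ∀ w}` is a neighbourhood of `1` in `Π_{w∣v} E_w`** (product of valued balls around `1`; a uniformizer power
realises the radius). [cite: CasselsFrohlichANT1967, Ch. II §10–§11] -/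
theorem localRing_box_sub_one_mem_nhds_one (n : ℕ) :
    {x : LocalRing E v | ∀ w : PlacesOver E v, Valued.v (x w - 1) < WithZero.exp (-(n : ℤ))} ∈ 𝓝 (1 : LocalRing E v) := by
  have hset : {x : LocalRing E v | ∀ w : PlacesOver E v, Valued.v (x w - 1) < WithZero.exp (-(n : ℤ))} =
      Set.pi Set.univ fun w : PlacesOver E v => {y : w.1.adicCompletion E | Valued.v (y - 1) < WithZero.exp (-(n : ℤ))} := by
    ext x; simp only [Set.mem_setOf_eq, Set.mem_pi, Set.mem_univ, forall_const]
  rw [hset]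
  refine set_pi_mem_nhds Set.finite_univ fun w _ => ?_
  obtain ⟨π, hπ⟩ := w.1.valuation_exists_uniformizer E
  have hπn : Valued.v (algebraMap E (w.1.adicCompletion E) π ^ n) = WithZero.exp (-(n : ℤ)) := by
    rw [map_pow]
    change Valued.v ((π : E) : w.1.adicCompletion E) ^ n = _
    rw [HeightOneSpectrum.valuedAdicCompletion_eq_valuation', hπ, ← WithZero.exp_nsmul, smul_neg, nsmul_eq_mul, mul_one]
  rw [← hπn]
  have h1 : (1 : LocalRing E v) w = 1 := rfl
  rw [h1]
  exact ball_mem_nhds w.1 (1 : w.1.adicCompletion E) _ (by rw [hπn]; exact WithZero.exp_ne_zero)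

/-- **Every neighbourhood of `1` in `Π_{w∣v} E_w` contains a box** `{x : v_w(x_w − 1) < q_w^{−n} ∀ w}` (product topology; ★ `exists_exp_lt_of_mem_nhds` per place and a
common exponent). [cite: CasselsFrohlichANT1967, Ch. II §10–§11] -/
theorem exists_localRing_box_subset_of_mem_nhds_one {t : Set (LocalRing E v)} (ht : t ∈ 𝓝 (1 : LocalRing E v)) :
    ∃ n : ℕ, {x : LocalRing E v | ∀ w : PlacesOver E v, Valued.v (x w - 1) < WithZero.exp (-(n : ℤ))} ⊆ t := by
  classical
  rw [nhds_pi, Filter.mem_pi] at ht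
  obtain ⟨I, -, s, hs, hsub⟩ := ht
  have hn : ∀ w : PlacesOver E v, ∃ n : ℕ, ∀ y : w.1.adicCompletion E, Valued.v (y - 1) < WithZero.exp (-(n : ℤ)) → y ∈ s w :=
    fun w => exists_exp_lt_of_mem_nhds w.1 (hs w)
  choose n hn using hn
  refine ⟨Finset.univ.sup n, fun x hx => hsub fun w _ => hn w (x w) (lt_of_lt_of_le (hx w) ?_)⟩
  rw [WithZero.exp_le_exp, neg_le_neg_iff, Nat.cast_le]
  exact Finset.le_sup (Finset.mem_univ w)

omit [NumberField F] in
/-- `(u⁻¹)_w = (u_w)⁻¹` for a unit `u` of `Π_{w∣v} E_w`. [folklore] -/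
private theorem coe_inv_apply_eq_inv (u : (LocalRing E v)ˣ) (w : PlacesOver E v) :
    ((u⁻¹ : (LocalRing E v)ˣ) : LocalRing E v) w = ((u : LocalRing E v) w)⁻¹ := by
  have h := congrFun u.inv_mul w
  rw [Pi.mul_apply, Pi.one_apply] at h
  exact eq_inv_of_mul_eq_one_left h

/-! ## §2 Continuous `ℂˣ`-characters of `(Π_{w ∣ v} E_w)^×` are locally constant -/

/-- **A CONTINUOUS CHARACTER `χ : (Π_{w∣v} E_w)^× → ℂˣ` IS TRIVIAL ON A PRINCIPAL CONGRUENCE BOX**: there is `n` with `χ u = 1` whenever `v_w(u_w − 1) < q_w^{−(n+1)}`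
for all `w`.  (The box is a subgroup by the ultrametric inequality; its image lies in a neighbourhood of `1 ∈ ℂˣ` without non-trivial subgroups, ★
`GroupTheory.PiCharacter.isNSSNhd_units_complex`.)  The finite-place half of «a quasi-character of a local field is trivial on some `1 + 𝔭^n`». [cite: TateThesis1967, §2.3] -/
theorem exists_forall_box_apply_eq_one (χ : (LocalRing E v)ˣ →* ℂˣ) (hχ : Continuous χ) :
    ∃ n : ℕ, ∀ u : (LocalRing E v)ˣ,
      (∀ w : PlacesOver E v, Valued.v ((u : LocalRing E v) w - 1) < WithZero.exp (-((n + 1 : ℕ) : ℤ))) → χ u = 1 := by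
  obtain ⟨hV1, hVnss⟩ := Literature.GroupTheory.PiCharacter.isNSSNhd_units_complex
  -- `χ⁻¹(V)` is a neighbourhood of `1` in the unit group, i.e. contains `val⁻¹(t)` for a neighbourhood `t` of `1` in `Π E_w`
  have hpre : χ ⁻¹' {u : ℂˣ | ‖(u : ℂ) - 1‖ < 2⁻¹} ∈ 𝓝 (1 : (LocalRing E v)ˣ) := by
    refine hχ.continuousAt.preimage_mem_nhds ?_
    rw [map_one]
    exact hV1
  rw [(isEmbedding_units_val_localRing E v).nhds_eq_comap, Units.val_one, Filter.mem_comap] at hpre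
  obtain ⟨t, ht, hsub⟩ := hpre
  obtain ⟨n, hn⟩ := exists_localRing_box_subset_of_mem_nhds_one E v ht
  refine ⟨n, ?_⟩
  -- the box of exponent `n + 1` as a subgroup of the unit group
  set ε : WithZero (Multiplicative ℤ) := WithZero.exp (-((n + 1 : ℕ) : ℤ)) with hε
  have hε1 : ε < 1 := by
    rw [hε, ← WithZero.exp_zero, WithZero.exp_lt_exp]
    omega
  have hεn : ε ≤ WithZero.exp (-(n : ℤ)) := by
    rw [hε, WithZero.exp_le_exp]
    omega
  have hvone : ∀ (w : PlacesOver E v) (a : w.1.adicCompletion E), Valued.v (a - 1) < ε → Valued.v a = 1 := fun w a ha => by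
    have h := Valuation.map_eq_of_sub_lt Valued.v (x := (1 : w.1.adicCompletion E)) (y := a) (by rw [Valuation.map_one]; exact lt_trans ha hε1)
    rwa [Valuation.map_one] at h
  let H : Subgroup (LocalRing E v)ˣ :=
    { carrier := {u | ∀ w : PlacesOver E v, Valued.v ((u : LocalRing E v) w - 1) < ε}
      one_mem' := fun w => by
        have h1 : ((1 : (LocalRing E v)ˣ) : LocalRing E v) w = 1 := rfl
        rw [h1, sub_self, Valuation.map_zero]
        exact WithZero.exp_pos
      mul_mem' := fun {a b} ha hb w => by
        simp only [Set.mem_setOf_eq] at ha hb ⊢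
        rw [Units.val_mul, Pi.mul_apply]
        have hid : (a : LocalRing E v) w * (b : LocalRing E v) w - 1 =
            ((a : LocalRing E v) w - 1) * ((b : LocalRing E v) w - 1) + (((a : LocalRing E v) w - 1) + ((b : LocalRing E v) w - 1)) := by ring
        rw [hid]
        refine Valuation.map_add_lt _ ?_ (Valuation.map_add_lt _ (ha w) (hb w))
        rw [Valuation.map_mul]
        calc Valued.v ((a : LocalRing E v) w - 1) * Valued.v ((b : LocalRing E v) w - 1)
            ≤ Valued.v ((a : LocalRing E v) w - 1) * 1 := mul_le_mul_right (le_of_lt (lt_trans (hb w) hε1)) _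
          _ < ε := by rw [mul_one]; exact ha w
      inv_mem' := fun {a} ha w => by
        simp only [Set.mem_setOf_eq] at ha ⊢
        rw [coe_inv_apply_eq_inv]
        have ha1 : Valued.v ((a : LocalRing E v) w) = 1 := hvone w _ (ha w)
        have hane : (a : LocalRing E v) w ≠ 0 := fun h0 => by
          rw [h0, Valuation.map_zero] at ha1
          exact zero_ne_one ha1
        have hid : ((a : LocalRing E v) w)⁻¹ - 1 = ((a : LocalRing E v) w)⁻¹ * (1 - (a : LocalRing E v) w) := by
          field_simp
        rw [hid, Valuation.map_mul, map_inv₀, ha1, inv_one, one_mul, Valuation.map_sub_swap]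
        exact ha w }
  -- `χ(H)` is a subgroup of `ℂˣ` inside the NSS neighbourhood, hence trivial
  have hHV : ((H.map χ : Subgroup ℂˣ) : Set ℂˣ) ⊆ {u : ℂˣ | ‖(u : ℂ) - 1‖ < 2⁻¹} := by
    rintro _ ⟨u, hu, rfl⟩
    refine hsub ?_
    rw [Set.mem_preimage]
    exact hn fun w => lt_of_lt_of_le (hu w) hεn
  have hbot := hVnss (H.map χ) hHV
  intro u hu
  have hmem : χ u ∈ H.map χ := ⟨u, hu, rfl⟩
  rw [hbot] at hmem
  exact Subgroup.mem_bot.1 hmem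

/-- **A CONTINUOUS CHARACTER OF `(Π_{w∣v} E_w)^×` IS LOCALLY CONSTANT**: `χ u = χ u₀` for all `u` near `u₀`. [cite: TateThesis1967, §2.3] -/
theorem eventually_apply_eq_of_continuous (χ : (LocalRing E v)ˣ →* ℂˣ) (hχ : Continuous χ) (u₀ : (LocalRing E v)ˣ) :
    ∀ᶠ u in 𝓝 u₀, χ u = χ u₀ := by
  obtain ⟨n, hn⟩ := exists_forall_box_apply_eq_one E v χ hχ
  -- the box around `1`, pulled back to `u₀` by left translation
  have hbox : {u : (LocalRing E v)ˣ | ∀ w : PlacesOver E v,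
      Valued.v ((u : LocalRing E v) w - 1) < WithZero.exp (-((n + 1 : ℕ) : ℤ))} ∈ 𝓝 (1 : (LocalRing E v)ˣ) := by
    have h := localRing_box_sub_one_mem_nhds_one E v (n + 1)
    rw [(isEmbedding_units_val_localRing E v).nhds_eq_comap, Units.val_one]
    exact Filter.preimage_mem_comap h
  have hmul : Tendsto (fun u : (LocalRing E v)ˣ => u₀⁻¹ * u) (𝓝 u₀) (𝓝 1) := by
    have h := (continuous_const_mul u₀⁻¹).tendsto u₀
    rwa [inv_mul_cancel] at h
  filter_upwards [hmul.eventually hbox] with u hu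
  have h1 : χ (u₀⁻¹ * u) = 1 := hn _ hu
  rw [map_mul, map_inv, inv_mul_eq_one] at h1
  exact h1.symm

/-- **Local constancy at units of a function read through the unit group**: if `f y = g (y as a unit)` at every unit `y` of `Π E_w` and `g` is constant near
every point of the unit group, then `f` is constant near every unit (units are open, ★ `isOpen_setOf_isUnit_localRing`, and `y ↦ (y as a unit)` is continuous
on them, ★ `isEmbedding_units_val_localRing`). [cite: TateThesis1967, §2.3] -/
theorem eventually_eq_of_eq_apply_unit_of_locallyConstant {X : Type*} {g : (LocalRing E v)ˣ → X}
    (hg : ∀ u₀ : (LocalRing E v)ˣ, ∀ᶠ u in 𝓝 u₀, g u = g u₀) {f : LocalRing E v → X}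
    (hf : ∀ (y : LocalRing E v) (hy : IsUnit y), f y = g hy.unit) {x : LocalRing E v} (hx : IsUnit x) :
    ∀ᶠ y in 𝓝 x, f y = f x := by
  classical
  have hU : {y : LocalRing E v | IsUnit y} ∈ 𝓝 x := (isOpen_setOf_isUnit_localRing E v).mem_nhds hx
  set lift : LocalRing E v → (LocalRing E v)ˣ := fun y => if h : IsUnit y then h.unit else 1 with hlift_def
  have hlift : ContinuousOn lift {y : LocalRing E v | IsUnit y} := by
    rw [(isEmbedding_units_val_localRing E v).continuousOn_iff]
    refine continuousOn_id.congr fun y hy => ?_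
    rw [Set.mem_setOf_eq] at hy
    simp only [Function.comp_apply, hlift_def, dif_pos hy, IsUnit.unit_spec, id]
  have hlx : lift x = hx.unit := by simp only [hlift_def, dif_pos hx]
  have htend : Tendsto lift (𝓝[{y : LocalRing E v | IsUnit y}] x) (𝓝 (lift x)) := hlift x hx
  have hev : ∀ᶠ y in 𝓝[{y : LocalRing E v | IsUnit y}] x, g (lift y) = g (lift x) := htend.eventually (hg (lift x))
  rw [eventually_nhdsWithin_iff] at hev
  filter_upwards [hev, hU] with y hy hyU
  rw [hf y hyU, hf x hx, ← hlx]
  have hly : lift y = hyU.unit := by simp only [hlift_def, dif_pos hyU]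
  rw [← hly]
  exact hy hyU

end Literature.NumberTheory.Automorphic.UnitaryGroup

end
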